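import Summits.Ventures.PackingBounds.Configurations.Simplex

/-!
# Antipodal doubling of a spherical code; the `±` simplex; `A(n, arccos s) ≥ 2n + 2` for `s ≥ 1/n`

Framing: lottery ticket; floor = certified bounds/negative ranges. Venture `PackingBounds` (cell `pub-packcert`, seat
`pub-packcert-sdp`), ATTAINED side of the cell's `A(n, arccos s)` table (B2c).

* `exists_code_antipodal_double`: a code `C` of unit vectors of `ℝⁿ` whose pairwise inner products are `≤ s` *in
  absolute value* (`0 ≤ s < 1`) contains no antipodal pair, so `C ∪ (-C)` is a code of `2 |C|` unit vectors with pairwise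
  inner products `≤ s` (the new values are `-⟪x, y⟫ ≤ |⟪x, y⟫| ≤ s` and `⟪x, -x⟫ = -1`).
* `exists_pm_simplex`: doubling the regular simplex of `ℝⁿ` (`Config.Simplex.exists_config`: `n + 1` unit vectors with
  pairwise inner products `-1/n`) gives, for `n ≥ 2`, `2n + 2` unit vectors with pairwise inner products `≤ 1/n` (the
  minimal vectors of the dual lattice `Aₙ*`), i.e. `A(n, arccos s) ≥ 2n + 2` for every `s ≥ 1/n`.
* Rows for the five B2c cells that carried no attained entry beyond the cross-polytope's `2n`:
  `A(13, arccos 1/9) ≥ 28`, `A(14, arccos 1/11) ≥ 30`, `A(15, arccos 1/11) ≥ 32`, `A(16, arccos 1/11) ≥ 34`,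
  `A(17, arccos 1/11) ≥ 36` (certified three-point values of the cell: `45, 41, 46, 52, 57`). Baseline constructions, no
  optimality claim (at `(9, 1/11)` the tree already has `21 > 2n + 2`, `Config.CodeEleventh9`).

## References
* J. H. Conway, N. J. A. Sloane, *Sphere Packings, Lattices and Groups*, 3rd ed., Ch. 1 §2.3, Ch. 4 §6.6 (`Aₙ*`).
  [`ConwaySloane1999`]
-/

noncomputable section

open Finset
open scoped RealInnerProductSpace

namespace Summit.Ventures.PackingBounds.SphericalCodes

/-- **Antipodal doubling.** If `C` is a set of unit vectors of `ℝⁿ` with `|⟪x, y⟫| ≤ s` for distinct members, where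
`0 ≤ s < 1`, then `C ∪ (-C)` has `2 |C|` members, all unit vectors, with pairwise inner products `≤ s`. -/
theorem exists_code_antipodal_double {n : ℕ} {s : ℝ} (hs0 : 0 ≤ s) (hs1 : s < 1)
    (C : Finset (EuclideanSpace ℝ (Fin n))) (h1 : ∀ x ∈ C, ‖x‖ = 1)
    (h2 : ∀ x ∈ C, ∀ y ∈ C, x ≠ y → |inner ℝ x y| ≤ s) :
    ∃ C' : Finset (EuclideanSpace ℝ (Fin n)), C'.card = 2 * C.card ∧ (∀ x ∈ C', ‖x‖ = 1) ∧
      ∀ x ∈ C', ∀ y ∈ C', x ≠ y → inner ℝ x y ≤ s := by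
  classical
  have hxx : ∀ x ∈ C, inner ℝ x x = 1 := fun x hx => by
    rw [real_inner_self_eq_norm_sq, h1 x hx, one_pow]
  -- `C` and `-C` are disjoint: an antipodal pair inside `C` would have `|⟪x, -x⟫| = 1 > s`
  have hdisj : Disjoint C (C.image fun x => -x) := by
    rw [Finset.disjoint_left]
    intro x hx hx'
    obtain ⟨y, hy, hyx⟩ := mem_image.mp hx'
    have hne : y ≠ x := by
      intro h
      rw [h] at hyx
      have h0 := congrArg (fun z => inner ℝ z x) hyx
      simp only [inner_neg_left, hxx x hx] at h0
      norm_num at h0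
    have h3 := h2 y hy x hx hne
    rw [← hyx, inner_neg_right, hxx y hy, abs_neg, abs_one] at h3
    linarith
  refine ⟨C ∪ C.image (fun x => -x), ?_, ?_, ?_⟩
  · rw [card_union_of_disjoint hdisj, card_image_of_injective _ neg_injective]; ring
  · intro x hx
    rcases mem_union.mp hx with hx | hx
    · exact h1 x hx
    · obtain ⟨y, hy, rfl⟩ := mem_image.mp hx
      rw [norm_neg]; exact h1 y hy
  · intro x hx y hy hxy
    rcases mem_union.mp hx with hx | hx <;> rcases mem_union.mp hy with hy | hy
    · exact (le_abs_self _).trans (h2 x hx y hy hxy)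
    · obtain ⟨y0, hy0, rfl⟩ := mem_image.mp hy
      rw [inner_neg_right]
      by_cases h0 : x = y0
      · subst h0; rw [hxx x hx]; linarith
      · exact (neg_le_abs _).trans (h2 x hx y0 hy0 h0)
    · obtain ⟨x0, hx0, rfl⟩ := mem_image.mp hx
      rw [inner_neg_left]
      by_cases h0 : x0 = y
      · subst h0; rw [hxx x0 hx0]; linarith
      · exact (neg_le_abs _).trans (h2 x0 hx0 y hy h0)
    · obtain ⟨x0, hx0, rfl⟩ := mem_image.mp hx
      obtain ⟨y0, hy0, rfl⟩ := mem_image.mp hy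
      rw [inner_neg_left, inner_neg_right, neg_neg]
      exact (le_abs_self _).trans (h2 x0 hx0 y0 hy0 fun h => hxy (by rw [h]))

/-- **The `±` simplex (every `n ≥ 2`).** There are `2n + 2` unit vectors of `ℝⁿ` — a regular simplex and its antipodes, the
minimal vectors of `Aₙ*` — with pairwise inner products `≤ 1/n` (values `-1, ±1/n`); hence `A(n, arccos s) ≥ 2n + 2` for
every `s ≥ 1/n`. [cite: ConwaySloane1999, Ch. 4 §6.6] -/
theorem exists_pm_simplex (n : ℕ) (hn : 2 ≤ n) : ∃ C : Finset (EuclideanSpace ℝ (Fin n)), C.card = 2 * n + 2 ∧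
    (∀ x ∈ C, ‖x‖ = 1) ∧ ∀ x ∈ C, ∀ y ∈ C, x ≠ y → inner ℝ x y ≤ 1 / (n : ℝ) := by
  obtain ⟨C, hc, h1, h2, -⟩ := Config.Simplex.exists_config (n := n) (N := n + 1) (by omega) le_rfl
  have hn1 : (1 : ℝ) < n := by exact_mod_cast hn
  have hN : ((n + 1 : ℕ) : ℝ) - 1 = n := by push_cast; ring
  obtain ⟨C', hc', h1', h2'⟩ := exists_code_antipodal_double (s := 1 / (n : ℝ)) (by positivity)
    ((div_lt_one (by linarith)).mpr hn1) C h1 (fun x hx y hy hxy => by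
      rw [h2 x hx y hy hxy, hN, abs_div, abs_neg, abs_one, abs_of_pos (by linarith)])
  exact ⟨C', by rw [hc', hc]; ring, h1', h2'⟩

/-! ## Attained-side rows: `A(n, arccos s) ≥ 2n + 2` at the five B2c cells with `s ≥ 1/n` and no entry so far -/

/-- Relaxing the angle of a code. -/
private theorem relax {n N : ℕ} {s t : ℝ} (hst : s ≤ t)
    (h : ∃ C : Finset (EuclideanSpace ℝ (Fin n)), C.card = N ∧ (∀ x ∈ C, ‖x‖ = 1) ∧
      ∀ x ∈ C, ∀ y ∈ C, x ≠ y → inner ℝ x y ≤ s) :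
    ∃ C : Finset (EuclideanSpace ℝ (Fin n)), C.card = N ∧ (∀ x ∈ C, ‖x‖ = 1) ∧
      ∀ x ∈ C, ∀ y ∈ C, x ≠ y → inner ℝ x y ≤ t := by
  obtain ⟨C, hc, h1, h2⟩ := h
  exact ⟨C, hc, h1, fun x hx y hy hxy => (h2 x hx y hy hxy).trans hst⟩

/-- **`A(13, arccos 1/9) ≥ 28`** (the `±` simplex; cosine `1/13 ≤ 1/9`; the cell's certified value is `45`). -/
theorem exists_code_dim13_ninth_28 : ∃ C : Finset (EuclideanSpace ℝ (Fin 13)), C.card = 28 ∧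
    (∀ x ∈ C, ‖x‖ = 1) ∧ ∀ x ∈ C, ∀ y ∈ C, x ≠ y → inner ℝ x y ≤ 1 / 9 :=
  relax (by norm_num) (exists_pm_simplex 13 (by norm_num))

/-- **`A(14, arccos 1/11) ≥ 30`** (the `±` simplex; cosine `1/14 ≤ 1/11`; the cell's certified value is `41`). -/
theorem exists_code_dim14_eleventh_30 : ∃ C : Finset (EuclideanSpace ℝ (Fin 14)), C.card = 30 ∧
    (∀ x ∈ C, ‖x‖ = 1) ∧ ∀ x ∈ C, ∀ y ∈ C, x ≠ y → inner ℝ x y ≤ 1 / 11 :=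
  relax (by norm_num) (exists_pm_simplex 14 (by norm_num))

/-- **`A(15, arccos 1/11) ≥ 32`** (the `±` simplex; cosine `1/15 ≤ 1/11`; the cell's certified value is `46`). -/
theorem exists_code_dim15_eleventh_32 : ∃ C : Finset (EuclideanSpace ℝ (Fin 15)), C.card = 32 ∧
    (∀ x ∈ C, ‖x‖ = 1) ∧ ∀ x ∈ C, ∀ y ∈ C, x ≠ y → inner ℝ x y ≤ 1 / 11 :=
  relax (by norm_num) (exists_pm_simplex 15 (by norm_num))

/-- **`A(16, arccos 1/11) ≥ 34`** (the `±` simplex; cosine `1/16 ≤ 1/11`; the cell's certified value is `52`). -/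
theorem exists_code_dim16_eleventh_34 : ∃ C : Finset (EuclideanSpace ℝ (Fin 16)), C.card = 34 ∧
    (∀ x ∈ C, ‖x‖ = 1) ∧ ∀ x ∈ C, ∀ y ∈ C, x ≠ y → inner ℝ x y ≤ 1 / 11 :=
  relax (by norm_num) (exists_pm_simplex 16 (by norm_num))

/-- **`A(17, arccos 1/11) ≥ 36`** (the `±` simplex; cosine `1/17 ≤ 1/11`; the cell's certified value is `57`). -/
theorem exists_code_dim17_eleventh_36 : ∃ C : Finset (EuclideanSpace ℝ (Fin 17)), C.card = 36 ∧
    (∀ x ∈ C, ‖x‖ = 1) ∧ ∀ x ∈ C, ∀ y ∈ C, x ≠ y → inner ℝ x y ≤ 1 / 11 :=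
  relax (by norm_num) (exists_pm_simplex 17 (by norm_num))

end Summit.Ventures.PackingBounds.SphericalCodes
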